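import Literature.AnabelianGeometry.EtaleTheta.Discharge.Sec2OrbitEmbeddingStandard
import Literature.AnabelianGeometry.EtaleTheta.StandardEnvOfSetting
import HarnessLib

/-!
# [EtTh] Def 2.7 / Cor 2.8 at the §1 model: the orbit data `ofEmbedding` ARE of standard type once `η̈^{Θ,ℤ}` is of
# standard type in the sense of Def 1.9 (ii) (proof-only; the Route-2 binder `hstd` from the §1 input)

Mochizuki, *The Étale Theta Function …* [EtTh], Publ. RIMS 45 (2009): Def 1.9 (i)(ii) p. 29 ("standard set of
values … the unique value of maximal order … is equal to `±1`"), Prop 1.4 (iii) p. 22 ("`H¹(G_L, Δ_Θ) ≅ (L^×)^∧`"),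
Def 2.7 p. 41 ("we shall also refer to … as being of standard type"), Cor 2.8 (i) p. 42
[cite: MochizukiEtTh2009, Def 2.7 p.41].

Cell abc-iut, layer L2, seat abc-iut-w5-d118 (gen 5), GAP-LEDGER G-w5d169-2 ROUTE 2 (abc-iut-L2-lead ROWS #14b R250 /
self-named row «ROUTE-2 BINDER hstd ⟸ DEF 1.9 (ii)»).  PROOF-ONLY (no `def`, no instance, no new `Prop` fact).  Both
ROUTE-2 files for the binder `hroot` of [IUTchII] Prop 3.4 (i) — abc-iut-w5-d118's `EtaleThetaDataOfSettingRootHypOfCor28i`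
(p443943 / v2 p445404) and abc-iut-w6-d051's companion-free twin (p445736) — take the standing hypothesis of [EtTh]
Cor 2.8 (i), «`η̈^{Θ,ℤ×μ₂}` is of standard type», as the binder `hstd : (ofEmbedding ε hC hS).IsStandard` (abc-iut-L2-t2's
Def 2.7 predicate on the orbit data).  THIS file discharges it from the §1 input print actually names (Def 2.7: "if
`η̈^{Θ,ℤ}` is of standard type [Def 1.9 (ii)], then we shall also refer to …"): for an orbit embedding `ε` whose two points
ARE the Def 1.9 data of a `S : M.StandardData E.toKummerData` (`ε.tau = S.tau`, `ε.tauInv = S.tauInv`) at which the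
evaluation maps are injective ("`H¹(G_L, Δ_Θ) ≅ (L^×)^∧`", Prop 1.4 (iii); the `AnchoredPoint` clause of abc-iut-L2-t6),
**`MuTwoSetting.IsOfStandardType hC εZ S E.etaDd`** (= FACT-LIST F-0573 `MuTwoSetting.OrbitsOfStandardType C hC εZ S`, by
`Iff.rfl`) **⇒ `(ThetaOrbitData.ofEmbedding ε hC hS).IsStandard`**: the printed value `v = ±1 ∈ K̈^×` at `τ^{±1}` has
`v² = 1`, so the restriction to `D_{τ^{±1}}` of the corresponding orbit member is `2`-torsion — its cocycle squared is a
coboundary on `D_{τ^{±1}}` — which is abc-iut-L2-t2's §1-level criterion `ofEmbedding_isStandard_of`.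
* `MuTwoSetting.sq_eq_one_of_coe_eq_one_or_neg_one` — `v = ±1` in `ℚ̄_p` ⇒ `v² = 1` in `K̈^×`;
* `MuTwoSetting.exists_rep_sq_eq_coboundary_of_mem_valuesAt` — a value `±1` at an anchored point `y₀` yields an orbit
  member `σ·η̈^Θ`, a representative `f` and `d₀ ∈ Δ_Θ` with `f² = ∂d₀` on `D_{y₀}`;
* **`ThetaOrbitData.ofEmbedding_isStandard_of_isOfStandardType`**.
HONEST FRAMING: [EtTh] is refereed; statements about the TYPED interface only; nothing asserts that a `MuTwoSetting`,
`StandardData` or `OrbitEmbedding` exists for an actual curve; no side is taken on [IUTchIII] Cor 3.12; typed ≠ proved.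
-/

noncomputable section

namespace Literature.AnabelianGeometry.EtaleTheta

open Literature.AnabelianGeometry.SemiGraphs ThetaCovers

universe u

namespace MuTwoSetting

variable {p : ℕ} [Fact p.Prime] {M : MuTwoSetting p}

/-- `v = ±1` in `ℚ̄_p` forces `v² = 1` in `K̈^×`. [cite: MochizukiEtTh2009, Def 1.9 (ii) p.29] -/
theorem sq_eq_one_of_coe_eq_one_or_neg_one (v : (↥M.Kdd)ˣ)
    (hv : ((v : M.Kdd) : PadicAlgCl p) = 1 ∨ ((v : M.Kdd) : PadicAlgCl p) = -1) : v ^ 2 = 1 := by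
  apply Units.ext
  apply Subtype.ext
  have h2 : (((v ^ 2 : (↥M.Kdd)ˣ) : M.Kdd) : PadicAlgCl p) = ((v : M.Kdd) : PadicAlgCl p) ^ 2 := by
    rw [Units.val_pow_eq_pow_val]
    push_cast
    rfl
  show (((v ^ 2 : (↥M.Kdd)ˣ) : M.Kdd) : PadicAlgCl p) = (((1 : (↥M.Kdd)ˣ) : M.Kdd) : PadicAlgCl p)
  rw [h2, Units.val_one]
  push_cast
  rcases hv with h | h <;> rw [h] <;> norm_num

/-- **A value `±1` at an anchored point gives a `2`-torsion restriction**: if `v ∈ η̈^{Θ,ℤ}|_{y₀}` (a value of the orbit of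
`x` at the non-cuspidal point `y₀`, Def 1.9 (i)) satisfies `v = ±1`, and `evalAt` is injective at `y₀` (Prop 1.4 (iii)), then
for some orbit member `σ·x` and representative `f` there is `d₀ ∈ Δ_Θ` with `f(g)² = ∂d₀(g)` for all `g ∈ D_{y₀}`.
[cite: MochizukiEtTh2009, Def 1.9 (ii) p.29] -/
theorem exists_rep_sq_eq_coboundary_of_mem_valuesAt {E : M.toThetaSetting.KummerData} (hC : M.toThetaSetting.Compat)
    (εZ : M.GtpC) (x : M.toThetaSetting.H1 M.toThetaSetting.GtpYdd) (y₀ : ThetaSetting.NonCuspidalPoint E)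
    (hinj : Function.Injective y₀.evalAt) {v : (↥M.Kdd)ˣ} (hvV : v ∈ valuesAt hC εZ x y₀)
    (hv : ((v : M.Kdd) : PadicAlgCl p) = 1 ∨ ((v : M.Kdd) : PadicAlgCl p) = -1) :
    ∃ (σ : M.PiTemp) (f : ↥(contCocycles M.toTheta M.toThetaSetting.DeltaTheta M.toThetaSetting.GtpYdd))
      (d₀ : ↥M.toThetaSetting.DeltaTheta),
      ContH1.mk f.1 f.2 =
        (haveI := hC.GtpYdd_normal; ContH1.conj M.toTheta M.toThetaSetting.DeltaTheta σ x) ∧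
      ∀ (g : M.PiTemp) (hg : g ∈ y₀.Dpt),
        f.1 ⟨g, y₀.Dpt_le hg⟩ ^ 2 = MulAut.conjNormal (M.toTheta g) d₀ * d₀⁻¹ := by
  haveI := hC.GtpYdd_normal
  obtain ⟨y, ⟨σ, -, rfl⟩, hyv⟩ := hvV
  -- a representative of the orbit member
  obtain ⟨f, hf⟩ : ∃ f : ↥(contCocycles M.toTheta M.toThetaSetting.DeltaTheta M.toThetaSetting.GtpYdd),
      ContH1.mk f.1 f.2 = ContH1.conj M.toTheta M.toThetaSetting.DeltaTheta σ x := by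
    induction (ContH1.conj M.toTheta M.toThetaSetting.DeltaTheta σ x) using QuotientGroup.induction_on with
    | H f => exact ⟨f, rfl⟩
  refine ⟨σ, f, ?_⟩
  -- the restricted class is `2`-torsion
  have hsq : ContH1.res M.toTheta M.toThetaSetting.DeltaTheta y₀.Dpt_le
      (ContH1.conj M.toTheta M.toThetaSetting.DeltaTheta σ x) ^ 2 = 1 := by
    apply hinj
    rw [map_pow, hyv, ← map_pow, sq_eq_one_of_coe_eq_one_or_neg_one v hv, map_one, map_one]
  rw [← hf] at hsq
  have hmem : (ContH1.resCocycle M.toTheta M.toThetaSetting.DeltaTheta y₀.Dpt_le f) ^ 2 ∈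
      (contCoboundaries M.toTheta M.toThetaSetting.DeltaTheta y₀.Dpt).subgroupOf
        (contCocycles M.toTheta M.toThetaSetting.DeltaTheta y₀.Dpt) :=
    (QuotientGroup.eq_one_iff _).mp (by rw [QuotientGroup.mk_pow]; exact hsq)
  obtain ⟨d₀, hd₀⟩ := (mem_contCoboundaries_iff _).mp (Subgroup.mem_subgroupOf.mp hmem)
  refine ⟨d₀, hf, fun g hg => ?_⟩
  have := congrFun hd₀ ⟨g, hg⟩
  exact this

end MuTwoSetting

namespace ThetaCovers.ThetaOrbitData

variable {p : ℕ} [Fact p.Prime] {M : MuTwoSetting p} {E : M.toThetaSetting.EtaleThetaData} {l : ℕ}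
  {C : E.DoubleUnderline l} {T : TemperedCoverData.{u} l} (ε : C.OrbitEmbedding T)

/-- **The orbit data `ofEmbedding` are of standard type (Def 2.7) when `η̈^{Θ,ℤ}` is of standard type (Def 1.9 (ii))** —
the ROUTE-2 binder `hstd` from the §1 input: for an orbit embedding whose points are the Def 1.9 data of `S` (`ε.tau = S.tau`,
`ε.tauInv = S.tauInv`), with `evalAt` injective at both ("`H¹(G_L, Δ_Θ) ≅ (L^×)^∧`"), `MuTwoSetting.IsOfStandardType hC εZ S η̈^Θ`
(= F-0573's `OrbitsOfStandardType`) implies `(ofEmbedding ε hC hS).IsStandard`. [cite: MochizukiEtTh2009, Def 2.7 p.41] -/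
theorem ofEmbedding_isStandard_of_isOfStandardType (hC : M.toThetaSetting.Compat) (hS : M.toThetaSetting.Sec2Hyps)
    (εZ : M.GtpC) (S : M.StandardData E.toKummerData) (hτ : ε.tau = S.tau) (hτ' : ε.tauInv = S.tauInv)
    (hinj : Function.Injective S.tau.evalAt) (hinj' : Function.Injective S.tauInv.evalAt)
    (hstd : M.IsOfStandardType hC εZ S E.etaDd) :
    (ofEmbedding ε hC hS).IsStandard := by
  obtain ⟨V, hV, v, hvV, -, -, hv⟩ := hstd
  rcases hV with rfl | rfl
  · obtain ⟨σ, f, d₀, hf, h2⟩ := MuTwoSetting.exists_rep_sq_eq_coboundary_of_mem_valuesAt hC εZ E.etaDd S.tau hinj hvV hv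
    exact ofEmbedding_isStandard_of ε hC hS σ f hf S.tau (Or.inl hτ.symm) d₀
      fun g hg => h2 g (Subgroup.mem_inf.1 hg).1
  · obtain ⟨σ, f, d₀, hf, h2⟩ :=
      MuTwoSetting.exists_rep_sq_eq_coboundary_of_mem_valuesAt hC εZ E.etaDd S.tauInv hinj' hvV hv
    exact ofEmbedding_isStandard_of ε hC hS σ f hf S.tauInv (Or.inr hτ'.symm) d₀
      fun g hg => h2 g (Subgroup.mem_inf.1 hg).1

/-- The same from F-0573's Def 2.7 predicate `OrbitsOfStandardType C hC εZ S` (which is `IsOfStandardType … η̈^Θ` by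
`Iff.rfl`). [cite: MochizukiEtTh2009, Def 2.7 p.41] -/
theorem ofEmbedding_isStandard_of_orbitsOfStandardType (hC : M.toThetaSetting.Compat) (hS : M.toThetaSetting.Sec2Hyps)
    (εZ : M.GtpC) (S : M.StandardData E.toKummerData) (hτ : ε.tau = S.tau) (hτ' : ε.tauInv = S.tauInv)
    (hinj : Function.Injective S.tau.evalAt) (hinj' : Function.Injective S.tauInv.evalAt)
    (hstd : MuTwoSetting.OrbitsOfStandardType C hC εZ S) :
    (ofEmbedding ε hC hS).IsStandard :=
  ofEmbedding_isStandard_of_isOfStandardType ε hC hS εZ S hτ hτ' hinj hinj' hstd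

end ThetaCovers.ThetaOrbitData

end Literature.AnabelianGeometry.EtaleTheta

end
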